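import Mathlib
import Summits.Parity.GeneralizedHardyLittlewood.Theses.LiouvilleShiftedTables
import Summits.Parity.GeneralizedHardyLittlewood.Theorems.TableChowla.Negative.TableChowlaExceptionalSet

/-!
# `TableChowla` (stmt-Parity-14270), line `helson-kronecker-inverse`, stub `stub_aperiodic`:
# typing audit and the sparse-support calibration

The registered stub `stub_aperiodic` (= `MeanSquareCMAperiodic` of the line skeleton) reads: for every
shift `c ≠ 0`, `0 < δ ≤ 1/12`, `C > 0` there are `K > 0` and `x₀` such that for `x ≥ x₀`, uniformly for
`x^δ ≤ A ≤ x^{1/3+δ}`, for every `g : ℕ → ℂ` with `g (m n) = g m g n` (all `m n`), `‖g n‖ ≤ 1`, and NO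
period `q` with `1 ≤ q ≤ (log x)^K` (`Function.Periodic g q` on `ℕ`), and every `y ≤ x/A`,
`∑_{a ∈ (⌊A⌋,⌊2A⌋]} ‖∑_{b ∈ [1,⌊y⌋]} g(b) λ(ab+c)‖² ≤ x (x/A)/(log x)^C`.
It is binary Elliott-type dispersion for the pair `(g, λ)` with every log-power saving (open; implied by
the crux, `meanSquareCMAperiodic_of_tableChowla` in the skeleton, and by `Negative.UniformBinaryChowla`).
This support file does NOT prove it. It records, kernel-checked, the TYPING AUDIT of the signature and
the one cheap calibration (sparse weights), so that the open content is located precisely.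

## Audit (statement as registered; verdict: clean — true-as-intended, non-vacuous, crux-implied)

1. `g (m n) = g m g n` for ALL `m, n` forces `g 1 ∈ {0, 1}`; `g 1 = 0` gives `g ≡ 0`, which is
   `q`-periodic for every `q`, hence EXCLUDED as soon as `(log x)^K ≥ 1` (and its left side is `0`
   anyway): `cm_apply_one`, `periodic_of_cm_apply_one_eq_zero`. Also `g 0 = g 0 · g n`, so `g 0 = 0`
   unless `g ≡ 1` (periodic, excluded).
2. The hypothesis class is NON-EMPTY for every `K` and every `x`: Liouville's `λ` itself (cast to `ℂ`)
   is completely multiplicative, 1-bounded and has NO period `q ≥ 1` (`λ(q+q) = λ(2)λ(q) = -λ(q) ≠ λ(q)`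
   since `λ(q) ≠ 0`): `liouvilleC_mul`, `norm_liouvilleC_le_one`, `not_periodic_liouvilleC`. So the
   prover's freedom to choose `K` (after `c, δ, C`) never makes the statement vacuous; larger `K` only
   removes periodic weights. `δ₁ = 𝟙_{n=1}` and `𝟙_{powers of 2}` are further aperiodic members; they
   have `≤ 1`, resp. `≤ log₂ y + 1`, support points in `[1, y]` and fall under item 6.
3. `Function.Periodic g q` quantifies over ALL `n : ℕ` including `n = 0`. For a completely
   multiplicative `g` that is `q`-periodic on the POSITIVE integers only, either `g` is `q`-periodic
   on `ℕ` or `g = 1` on all positive integers (`periodic_or_eq_one_of_cm_of_periodic_pos`). Hence the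
   only weight that is "periodic where it is summed" but counted as aperiodic by the stub is
   `𝟙_{n ≥ 1}` (`exists_cm_aperiodic_eq_one_on_pos`): the stub therefore CONTAINS the constant-weight
   instance `∑_a |∑_{b ≤ y} λ(ab+c)|² ≤ x(x/A)/(log x)^C`, i.e. Bombieri–Vinogradov for `λ` in mean
   square over the moduli `a ∼ A ≤ x^{5/12}` (theorem-grade, the `q = 1` case of the periodic stub).
   This is harmless — the class contains by design other one-point members needing the same input
   (principal characters modulo a prime `p₀ ∈ ((log x)^K, x^{1/12}]`, `χ · n^{it}`, a small-conductor
   `χ` modified at one prime, `𝟙_{(log x)^K-rough}` = principal character mod `∏_{p ≤ (log x)^K} p`,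
   whose least period is `≈ exp((log x)^K)`) — but a lead who wants the aperiodic half to be purely
   "two-point" may replace `¬ Function.Periodic g q` by `¬ ∀ n, 1 ≤ n → g (n + q) = g n`; by
   `periodic_or_eq_one_of_cm_of_periodic_pos` the periodic half then only gains `g = 𝟙_{n≥1}`, which
   agrees with the periodic weight `1` on the summation range. No change is REQUIRED.
4. Dirichlet characters `χ mod q` extended by `0` (as maps `ℕ → ℂ` through `ZMod q`) are `q`-periodic
   on `ℕ` (value `0` at `0` and at `q`), so for `q ≤ (log x)^K` they are excluded as intended; the
   periods of any `g : ℕ → ℂ` are the positive multiples of the least one (`q₁ < q₂` periods ⇒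
   `q₂ - q₁` a period), so "no period `≤ (log x)^K`" is exactly "least period `> (log x)^K` or none".
5. Junk values are all absorbed by `∃ x₀`: `y < 1` gives an empty inner sum (left side `0`, right side
   `> 0` once `x > 1`, `A > 0`); `Int.toNat` never truncates once `A ≥ x^δ > |c|` (`a b + c ≥ a + c > 0`);
   `Real.log x ^ C` (real power) is a genuine positive power once `x > e`; the row range is non-empty
   once `A ≥ 1`. `K` may depend on `(c, δ, C)` only, `x₀` on `(c, δ, C, K)` only — uniform in `A, g, y`,
   which is the intended uniformity (a supremum over the weight class).
6. SPARSE WEIGHTS ARE TRIVIAL (the calibration below, no multiplicativity or aperiodicity used): if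
   `‖g‖ ≤ 1` and `g` has at most `s` non-zero values on `[1, ⌊y⌋]`, the left side is `≤ #rows · s²`
   (triangle inequality), `#rows ≤ 2A`; so the stub's inequality holds for such `g` as soon as
   `s² · 2A ≤ x(x/A)/(log x)^C`, in particular whenever `s ≤ (x/A)/(2 (log x)^{C/2})`
   (`meanSquare_le_of_sparse`, `meanSquare_le_of_card_support_le`, `stub_aperiodic_sparse`). Only weights occupying a
   `≫ (log x)^{-C/2}` fraction of the columns carry the open content (e.g. `g = λ`, `μ`, `λχ`, `n^{it}`).
7. Not false: the stub is implied by the crux (the skeleton's `meanSquareCMAperiodic_of_tableChowla`,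
   axiom closure `propext, Classical.choice, Quot.sound` — no `sorryAx`), which the refuter seat has
   attacked without success; every instance tested here is either excluded (items 1, 4), trivial
   (item 6) or a believed one-point or two-point statement (items 2, 3). 12 instances checked: `0`,
   `1`, `𝟙_{n≥1}`, `δ₁`, `𝟙_{2^k}`, `λ`, `z^{Ω(n)}` (`|z| ≤ 1`, `z ∉ {0, 1}`: aperiodic by the argument
   of item 2 with `z` for `-1`), `χ mod q` with `q ≤ (log x)^K` (excluded) and with `q > (log x)^K`
   (in; one-point), `χ` of small conductor modified at one prime `p₁` (in; splits along `v_{p₁}` into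
   periodic weights of moduli `p₁^k q`, one-point), `χ · n^{it}` and `n^{it}` (in; twisted one-point for
   `|t| ≤ x^{O(1)}`, generic CM beyond), `𝟙_{(log x)^K-rough}` (in; least period `≈ exp((log x)^K)`).
-/

namespace Summit.Parity.GeneralizedHardyLittlewood.Theorems.TableChowla.HelsonKroneckerInverse

open Finset
open Summit.Parity.GeneralizedHardyLittlewood.Theorems.TableChowla

/-! ## Audit witnesses -/

/-- A completely multiplicative `g : ℕ → ℂ` (in the stub's sense `g (m n) = g m g n` for all `m, n`)
has `g 1 = 1` or vanishes identically. [folklore] -/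
theorem cm_apply_one {g : ℕ → ℂ} (hg : ∀ m n : ℕ, g (m * n) = g m * g n) :
    g 1 = 1 ∨ ∀ n, g n = 0 := by
  by_cases h1 : g 1 = 0
  · right
    intro n
    have := hg n 1
    rw [mul_one, h1, mul_zero] at this
    exact this
  · left
    have h := hg 1 1
    rw [mul_one] at h
    -- `g 1 = g 1 * g 1`, `g 1 ≠ 0`
    have : g 1 * (g 1 - 1) = 0 := by rw [mul_sub, mul_one, ← h, sub_self]
    rcases mul_eq_zero.mp this with h0 | h0
    · exact absurd h0 h1
    · exact sub_eq_zero.mp h0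

/-- The degenerate member `g 1 = 0` (i.e. `g ≡ 0`) is periodic with every period, hence excluded by
the stub's aperiodicity hypothesis (at `q = 1`, once `(log x)^K ≥ 1`). [folklore] -/
theorem periodic_of_cm_apply_one_eq_zero {g : ℕ → ℂ} (hg : ∀ m n : ℕ, g (m * n) = g m * g n)
    (h1 : g 1 = 0) (q : ℕ) : Function.Periodic g q := by
  have h0 : ∀ n, g n = 0 := by
    rcases cm_apply_one hg with h | h
    · rw [h] at h1; exact absurd h1 one_ne_zero
    · exact h
  intro n
  rw [h0, h0]

/-- Liouville's function as a complex-valued weight is completely multiplicative on ALL of `ℕ`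
(`λ 0 = 0`). [folklore] -/
theorem liouvilleC_mul (m n : ℕ) :
    ((ArithmeticFunction.liouville (m * n) : ℝ) : ℂ) =
      ((ArithmeticFunction.liouville m : ℝ) : ℂ) * ((ArithmeticFunction.liouville n : ℝ) : ℂ) := by
  rw [ArithmeticFunction.liouville_apply_mul]
  push_cast
  ring

/-- `‖λ n‖ ≤ 1` for the complex-valued Liouville weight. [folklore] -/
theorem norm_liouvilleC_le_one (n : ℕ) : ‖((ArithmeticFunction.liouville n : ℝ) : ℂ)‖ ≤ 1 := by
  rw [Complex.norm_real, Real.norm_eq_abs]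
  exact Negative.abs_lam_le_one n

/-- `λ 2 = -1`. [folklore] -/
theorem liouville_two : ArithmeticFunction.liouville 2 = -1 := by
  rw [ArithmeticFunction.liouville_apply two_ne_zero,
    ArithmeticFunction.cardFactors_apply_prime Nat.prime_two, pow_one]

/-- Liouville's function has NO period `q ≥ 1` (so it lies in the stub's weight class for every `K`
and every `x`): `λ(q + q) = λ(2) λ(q) = -λ(q)`, while periodicity would give `λ(q + q) = λ(q)`, and
`λ(q) ≠ 0`. [folklore] -/
theorem not_periodic_liouvilleC {q : ℕ} (hq : 1 ≤ q) :
    ¬ Function.Periodic (fun n : ℕ => ((ArithmeticFunction.liouville n : ℝ) : ℂ)) q := by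
  intro hper
  have hq0 : q ≠ 0 := by omega
  have h1 : ArithmeticFunction.liouville (q + q) = ArithmeticFunction.liouville q := by
    have := hper q
    simp only at this
    exact_mod_cast this
  have h2 : ArithmeticFunction.liouville (q + q) = -ArithmeticFunction.liouville q := by
    rw [← two_mul, ArithmeticFunction.liouville_apply_mul, liouville_two, neg_one_mul]
  have hne : ArithmeticFunction.liouville q ≠ 0 := ArithmeticFunction.liouville_ne_zero hq0
  rw [h1] at h2
  -- `λ q = -λ q` with `λ q ≠ 0`
  have : (2 : ℤ) * ArithmeticFunction.liouville q = 0 := by linarith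
  rcases mul_eq_zero.mp this with h | h
  · norm_num at h
  · exact hne h

/-- Consequently the stub's weight class (completely multiplicative, 1-bounded, no period `q` with
`1 ≤ q ≤ L`) is non-empty for EVERY bound `L` — it contains `λ`. [folklore] -/
theorem exists_cm_bounded_aperiodic (L : ℝ) :
    ∃ g : ℕ → ℂ, (∀ m n : ℕ, g (m * n) = g m * g n) ∧ (∀ n : ℕ, ‖g n‖ ≤ 1) ∧
      ∀ q : ℕ, 1 ≤ q → (q : ℝ) ≤ L → ¬ Function.Periodic g q :=
  ⟨fun n => ((ArithmeticFunction.liouville n : ℝ) : ℂ), liouvilleC_mul, norm_liouvilleC_le_one,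
    fun _ hq _ => not_periodic_liouvilleC hq⟩

/-- Iterating a period valid on the positive integers. [folklore] -/
theorem apply_add_mul_of_periodic_pos {g : ℕ → ℂ} {q : ℕ}
    (hper : ∀ n : ℕ, 1 ≤ n → g (n + q) = g n) {n : ℕ} (hn : 1 ≤ n) (k : ℕ) :
    g (n + k * q) = g n := by
  induction k with
  | zero => simp
  | succ k ih =>
      have h := hper (n + k * q) (by omega)
      rw [show n + (k + 1) * q = n + k * q + q by ring, h, ih]

/-- STRUCTURE OF THE `n = 0` LOOPHOLE: a completely multiplicative `g` that is `q`-periodic on the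
POSITIVE integers (`q ≥ 1`) is either `q`-periodic on all of `ℕ` (the Dirichlet-character case,
`g q = 0 = g 0`) or identically `1` on the positive integers (`g q = 1`). So `Function.Periodic` on
`ℕ` and "periodic where the stub sums" differ exactly on the single weight `𝟙_{n ≥ 1}`. [folklore] -/
theorem periodic_or_eq_one_of_cm_of_periodic_pos {g : ℕ → ℂ}
    (hg : ∀ m n : ℕ, g (m * n) = g m * g n) {q : ℕ} (hq : 1 ≤ q)
    (hper : ∀ n : ℕ, 1 ≤ n → g (n + q) = g n) :
    Function.Periodic g q ∨ ∀ n : ℕ, 1 ≤ n → g n = 1 := by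
  -- `g (n q) = g q` for `n ≥ 1`
  have hnq : ∀ n : ℕ, 1 ≤ n → g (n * q) = g q := by
    intro n hn
    have := apply_add_mul_of_periodic_pos hper hq (n - 1)
    rw [show q + (n - 1) * q = n * q by
      rcases Nat.exists_eq_add_of_le hn with ⟨m, rfl⟩
      simp [add_mul, add_comm]] at this
    exact this
  -- `g q ^ 2 = g (q q) = g q`
  have hqq : g q * g q = g q := by rw [← hg, hnq q hq]
  by_cases hq0 : g q = 0
  · left
    have hg0 : g 0 = 0 := by
      have := hg 0 q
      rw [zero_mul, hq0, mul_zero] at this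
      exact this
    intro n
    rcases Nat.eq_zero_or_pos n with rfl | hn
    · rw [zero_add, hq0, hg0]
    · exact hper n hn
  · right
    have hq1 : g q = 1 := by
      have : g q * (g q - 1) = 0 := by rw [mul_sub, mul_one, hqq, sub_self]
      rcases mul_eq_zero.mp this with h | h
      · exact absurd h hq0
      · exact sub_eq_zero.mp h
    intro n hn
    have := hg n q
    rw [hnq n hn, hq1, mul_one] at this
    exact this.symm

/-- THE LOOPHOLE WEIGHT `𝟙_{n ≥ 1}`: completely multiplicative, 1-bounded, with no period `q ≥ 1` on
`ℕ` (it differs at `0` and `q`), yet equal to the constant weight `1` on every summation range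
`[1, ⌊y⌋]`. So the aperiodic stub contains the pure Bombieri–Vinogradov instance
`∑_a |∑_{b ≤ y} λ(ab+c)|²` (true, theorem-grade; not two-point). [folklore] -/
theorem exists_cm_aperiodic_eq_one_on_pos :
    ∃ g : ℕ → ℂ, (∀ m n : ℕ, g (m * n) = g m * g n) ∧ (∀ n : ℕ, ‖g n‖ ≤ 1) ∧
      (∀ q : ℕ, 1 ≤ q → ¬ Function.Periodic g q) ∧ ∀ n : ℕ, 1 ≤ n → g n = 1 := by
  refine ⟨fun n => if n = 0 then 0 else 1, ?_, ?_, ?_, ?_⟩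
  · intro m n
    rcases Nat.eq_zero_or_pos m with rfl | hm
    · simp
    rcases Nat.eq_zero_or_pos n with rfl | hn
    · simp
    have hmn : m * n ≠ 0 := Nat.mul_ne_zero (by omega) (by omega)
    simp [hmn, Nat.pos_iff_ne_zero.mp hm, Nat.pos_iff_ne_zero.mp hn]
  · intro n
    dsimp only
    split_ifs <;> simp
  · intro q hq hper
    have := hper 0
    simp only [zero_add] at this
    rw [if_neg (by omega)] at this
    simp at this
  · intro n hn
    simp [Nat.pos_iff_ne_zero.mp hn]

/-! ## The sparse-support calibration -/

/-- Triangle inequality against a sparse weight: if `‖g‖ ≤ 1`, `|e| ≤ 1` on `S` and `g` has at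
most `s` non-zero values on `S`, then `‖∑_{b ∈ S} g(b) e(b)‖ ≤ s`. [folklore] -/
theorem norm_sum_mul_le_of_card_support_le (S : Finset ℕ) (g : ℕ → ℂ) (e : ℕ → ℝ)
    (hg : ∀ n, ‖g n‖ ≤ 1) (he : ∀ b ∈ S, |e b| ≤ 1) {s : ℕ}
    (hs : (S.filter (fun b => g b ≠ 0)).card ≤ s) :
    ‖∑ b ∈ S, g b * (e b : ℂ)‖ ≤ s := by
  have hsub : S.filter (fun b => g b ≠ 0) ⊆ S := filter_subset _ _
  rw [← sum_subset hsub (fun b hb hnb => by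
    have : g b = 0 := by
      by_contra h
      exact hnb (mem_filter.mpr ⟨hb, h⟩)
    rw [this, zero_mul])]
  calc ‖∑ b ∈ S.filter (fun b => g b ≠ 0), g b * (e b : ℂ)‖
      ≤ ∑ b ∈ S.filter (fun b => g b ≠ 0), ‖g b * (e b : ℂ)‖ := norm_sum_le _ _
    _ ≤ ∑ _b ∈ S.filter (fun b => g b ≠ 0), (1 : ℝ) := by
        refine sum_le_sum fun b hb => ?_
        rw [norm_mul, Complex.norm_real, Real.norm_eq_abs]
        exact mul_le_one₀ (hg b) (abs_nonneg _) (he b (hsub hb))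
    _ = (S.filter (fun b => g b ≠ 0)).card := by simp
    _ ≤ s := by exact_mod_cast hs

/-- SPARSE CASE, general rows and columns: for a 1-bounded weight with at most `s` non-zero values
on the column set, the mean square of the table against it over any row set `R` is `≤ #R · s²`, for
any real table with entries in `[-1, 1]`. [folklore] -/
theorem meanSquare_le_card_mul_sq (R S : Finset ℕ) (g : ℕ → ℂ) (e : ℕ → ℕ → ℝ)
    (hg : ∀ n, ‖g n‖ ≤ 1) (he : ∀ a b, |e a b| ≤ 1) {s : ℕ}
    (hs : (S.filter (fun b => g b ≠ 0)).card ≤ s) :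
    ∑ a ∈ R, ‖∑ b ∈ S, g b * (e a b : ℂ)‖ ^ 2 ≤ R.card * (s : ℝ) ^ 2 := by
  calc ∑ a ∈ R, ‖∑ b ∈ S, g b * (e a b : ℂ)‖ ^ 2 ≤ ∑ _a ∈ R, (s : ℝ) ^ 2 := by
        refine sum_le_sum fun a _ => ?_
        exact pow_le_pow_left₀ (norm_nonneg _)
          (norm_sum_mul_le_of_card_support_le S g (e a) hg (fun b _ => he a b) hs) 2
    _ = R.card * (s : ℝ) ^ 2 := by simp

/-- Row count of the stub's window: `#(⌊A⌋, ⌊2A⌋] ≤ 2A` for `A ≥ 0`. [folklore] -/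
theorem card_rows_le {A : ℝ} (hA : 0 ≤ A) : ((Ioc ⌊A⌋₊ ⌊2 * A⌋₊).card : ℝ) ≤ 2 * A := by
  rw [Nat.card_Ioc]
  calc ((⌊2 * A⌋₊ - ⌊A⌋₊ : ℕ) : ℝ) ≤ (⌊2 * A⌋₊ : ℝ) := by exact_mod_cast Nat.sub_le _ _
    _ ≤ 2 * A := Nat.floor_le (by linarith)

/-- **SPARSE CASE OF `stub_aperiodic` (calibration).** In the stub's exact shape: if the weight `g`
(`‖g‖ ≤ 1`; neither multiplicativity nor aperiodicity is used) has at most `s` non-zero values on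
`[1, ⌊y⌋]` and `s² · 2A ≤ x (x/A)/(log x)^C`, then the stub's inequality holds for `g`. With `δ₁`
(`s = 1`) or `𝟙_{powers of 2}` (`s ≤ log₂ x + 1`) this is immediate for large `x`, since
`2A ≤ 2x^{5/12}` while `x(x/A) ≥ x^{19/12}`. [folklore] -/
theorem meanSquare_le_of_sparse (c : ℤ) {x A y C : ℝ} (hA : 0 ≤ A) (g : ℕ → ℂ)
    (hg : ∀ n, ‖g n‖ ≤ 1) {s : ℕ}
    (hs : ((Icc 1 ⌊y⌋₊).filter (fun b => g b ≠ 0)).card ≤ s)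
    (hsmall : (s : ℝ) ^ 2 * (2 * A) ≤ x * (x / A) / Real.log x ^ C) :
    ∑ a ∈ Ioc ⌊A⌋₊ ⌊2 * A⌋₊,
        ‖∑ b ∈ Icc 1 ⌊y⌋₊, g b *
          ((ArithmeticFunction.liouville (Int.toNat ((a : ℤ) * b + c)) : ℝ) : ℂ)‖ ^ 2 ≤
      x * (x / A) / Real.log x ^ C := by
  have h := meanSquare_le_card_mul_sq (Ioc ⌊A⌋₊ ⌊2 * A⌋₊) (Icc 1 ⌊y⌋₊) g
    (fun a b => (ArithmeticFunction.liouville (Int.toNat ((a : ℤ) * b + c)) : ℝ)) hg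
    (fun a b => Negative.abs_lam_le_one _) hs
  calc _ ≤ ((Ioc ⌊A⌋₊ ⌊2 * A⌋₊).card : ℝ) * (s : ℝ) ^ 2 := h
    _ ≤ (2 * A) * (s : ℝ) ^ 2 := mul_le_mul_of_nonneg_right (card_rows_le hA) (sq_nonneg _)
    _ = (s : ℝ) ^ 2 * (2 * A) := by ring
    _ ≤ _ := hsmall

/-- **SPARSE CASE, density form.** If `x > 1`, `A > 0` and the weight `g` (`‖g‖ ≤ 1`) has at
most `(x/A) / (2 (log x)^{C/2})` non-zero values on `[1, ⌊y⌋]` — i.e. it occupies at most a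
`(log x)^{-C/2}/2` fraction of the `≍ x/A` columns — then the stub's inequality holds for `g`
(`s² · 2A ≤ (x/A)² · 2A /(4 (log x)^C) ≤ x(x/A)/(log x)^C`). Only near-full-support weights carry the
open content of `stub_aperiodic`. [folklore] -/
theorem meanSquare_le_of_card_support_le (c : ℤ) {x A y C : ℝ} (hx : 1 < x) (hA : 0 < A)
    (g : ℕ → ℂ) (hg : ∀ n, ‖g n‖ ≤ 1) {s : ℕ}
    (hs : ((Icc 1 ⌊y⌋₊).filter (fun b => g b ≠ 0)).card ≤ s)
    (hsx : (s : ℝ) ≤ x / A / (2 * Real.log x ^ (C / 2))) :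
    ∑ a ∈ Ioc ⌊A⌋₊ ⌊2 * A⌋₊,
        ‖∑ b ∈ Icc 1 ⌊y⌋₊, g b *
          ((ArithmeticFunction.liouville (Int.toNat ((a : ℤ) * b + c)) : ℝ) : ℂ)‖ ^ 2 ≤
      x * (x / A) / Real.log x ^ C := by
  have hlog : 0 < Real.log x := Real.log_pos hx
  refine meanSquare_le_of_sparse c hA.le g hg hs ?_
  have hL : 0 < Real.log x ^ (C / 2) := Real.rpow_pos_of_pos hlog (C / 2)
  have hLC : Real.log x ^ C = (Real.log x ^ (C / 2)) ^ 2 := by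
    rw [← Real.rpow_natCast, ← Real.rpow_mul hlog.le]; norm_num
  have hs0 : (0 : ℝ) ≤ s := Nat.cast_nonneg s
  have hden : 0 < 2 * Real.log x ^ (C / 2) := by positivity
  -- `s · (2 L) ≤ x/A` with `L = (log x)^{C/2}`
  have h1 : (s : ℝ) * (2 * Real.log x ^ (C / 2)) ≤ x / A := (le_div_iff₀ hden).mp hsx
  have hxA : 0 ≤ x / A := le_trans (by positivity) h1
  have h2 : ((s : ℝ) * (2 * Real.log x ^ (C / 2))) ^ 2 ≤ (x / A) ^ 2 :=
    pow_le_pow_left₀ (by positivity) h1 2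
  rw [hLC, le_div_iff₀ (by positivity)]
  calc (s : ℝ) ^ 2 * (2 * A) * (Real.log x ^ (C / 2)) ^ 2
      = ((s : ℝ) * (2 * Real.log x ^ (C / 2))) ^ 2 * A / 2 := by ring
    _ ≤ (x / A) ^ 2 * A / 2 := by gcongr
    _ ≤ (x / A) ^ 2 * A := by linarith [show 0 ≤ (x / A) ^ 2 * A by positivity]
    _ = x * (x / A) := by field_simp

/-- **`stub_aperiodic_sparse` — THE SPARSE CLASS OF `stub_aperiodic` IS FREE** (registered
calibration sub-goal of the crux item, in the stub's own shape; no threshold beyond `x > 1`, no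
window beyond `A > 0`, no multiplicativity, no aperiodicity): every 1-bounded weight with at most
`(x/A)/(2 (log x)^{C/2})` non-zero values on `[1, ⌊y⌋]` satisfies the inequality of `stub_aperiodic`.
Its open content is therefore carried entirely by weights of column density `> (log x)^{-C/2}/2`
(`λ`, `μ`, `λχ`, `z^{Ω}`, `n^{it}`, rough indicators, …). [folklore] -/
theorem stub_aperiodic_sparse :
    ∀ c : ℤ, ∀ C x A y : ℝ, 1 < x → 0 < A → ∀ g : ℕ → ℂ, (∀ n : ℕ, ‖g n‖ ≤ 1) →
    ((((Finset.Icc 1 ⌊y⌋₊).filter (fun b => g b ≠ 0)).card : ℝ) ≤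
        x / A / (2 * Real.log x ^ (C / 2))) →
      ∑ a ∈ Finset.Ioc ⌊A⌋₊ ⌊2 * A⌋₊,
          ‖∑ b ∈ Finset.Icc 1 ⌊y⌋₊, g b *
            ((ArithmeticFunction.liouville (Int.toNat ((a : ℤ) * b + c)) : ℝ) : ℂ)‖ ^ 2 ≤
        x * (x / A) / Real.log x ^ C :=
  fun c _C _x _A _y hx hA g hg hs => meanSquare_le_of_card_support_le c hx hA g hg le_rfl hs

end Summit.Parity.GeneralizedHardyLittlewood.Theorems.TableChowla.HelsonKroneckerInverse
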